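import Summits.QuantumAdvantage.QuantumAdvantage.Theorems.WbwVerifiableLineNoSpeedup.Negative.WeightedAdversaryBound
import Summits.QuantumAdvantage.QuantumAdvantage.Theorems.WhiteBoxWalkWbwVerifiableLineNoSpeedupCycleSurgeryAdversaryDefs

/-!
# Ambainis's relational adversary bound in average-degree form (crux
`WhiteBoxWalk.WbwVerifiableLineNoSpeedup`, stmt-QuantumAdvantage-2239, line `cycle-surgery-adversary`,
stub `stub_relationalAdversary`)

For the tree's query model `QQueryAlg` (`Literature/Computability/Cryptography/QuantumQuery.lean`)
and a promise problem `f` on `D ⊆ {0,1}ⁿ`: if `A` computes `f` with error `1/3` on `D`, and a finite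
relation `R ⊆ X × Y` is well formed (`RelWellFormed D f X Y R`: inside `D`, `f`-separating) and
satisfies Ambainis's product hypothesis `ProductBound R L` (`l_{x,i} · l_{y,i} ≤ L` on every related
pair and every bit where it differs), then

  `|R| ≤ 144 · A.queries · √L · √(|X| · |Y|)`      (`stub_relationalAdversary`).

This is [A. Ambainis, *Quantum lower bounds by quantum arguments*, JCSS 64 (2002), Thm 6] in
average-degree form (combine with min-degree bounds `d |X| ≤ |R|`, `d' |Y| ≤ |R|` to recover
`√(d d' / L) ≤ 144 T`); cf. [P. Høyer, R. Špalek, *Lower bounds on quantum query complexity*,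
Bull. EATCS 87 (2005), Thm 2]. It is obtained from the tree's parametric weighted adversary bound
`Negative.WeightedAdversary.card_le_queries_mul` (`|R|/72 ≤ T · √ℓ · (λ |R.fst| + |R.snd| / λ)` for
every `λ > 0`) with the balancing choice `λ = √|Y| / √|X|`. The vocabulary (`leftCount`,
`rightCount`, `ProductBound`, `RelWellFormed`) is the lead's definitions file
`…CycleSurgeryAdversaryDefs.lean`; `leftCount` / `rightCount` coincide definitionally with the
`l1` / `l2` of `WeightedAdversary.lean`. Sorry-free, no new definitions of kind `Prop`.
-/

noncomputable section

set_option linter.dupNamespace false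

namespace Summit.QuantumAdvantage.QuantumAdvantage.Theorems.WbwVerifiableLineNoSpeedup.CycleSurgery

open Literature.Computability.Cryptography Literature.Computability.QuantumComplexity

open Summit.QuantumAdvantage.QuantumAdvantage.Theorems.WbwVerifiableLineNoSpeedup.Negative.WeightedAdversary

/-- Balancing the two sides: `(√Y/√X) · X + Y / (√Y/√X) = 2 √X √Y` for `X, Y > 0` (stated for the
square roots `sX, sY`). [folklore] -/
theorem relAdv_balance_eq {sX sY aX aY : ℝ} (hsX : 0 < sX) (hsY : 0 < sY) (haX : sX * sX = aX)
    (haY : sY * sY = aY) : sY / sX * aX + aY / (sY / sX) = 2 * (sX * sY) := by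
  subst haX haY
  have hX0 : sX ≠ 0 := hsX.ne'
  have hY0 : sY ≠ 0 := hsY.ne'
  field_simp
  ring

/-- **stub_relationalAdversary** — Ambainis's relational adversary bound in AVERAGE-degree form
[A. Ambainis, *Quantum lower bounds by quantum arguments*, JCSS 64 (2002), Thm 6; Høyer–Špalek,
*Lower bounds on quantum query complexity*, EATCS Bull. 87 (2005), Thm 2], for the tree's model
`QQueryAlg` and PROMISE problems: if `A` computes `f` with error `1/3` on `D` and `R ⊆ X × Y` is
well formed (inside `D`, `f`-separating) with product bound `l_{x,i} l_{y,i} ≤ L`, then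
`|R| ≤ 144 · A.queries · √L · √(|X| · |Y|)`. Corollary of the tree's parametric weighted
adversary bound `Negative.WeightedAdversary.card_le_queries_mul`
(`|R|/72 ≤ T √L (λ |R.fst| + |R.snd| / λ)`) with `λ = √|Y| / √|X|`, `R.fst ⊆ X`, `R.snd ⊆ Y`;
the product hypothesis of that theorem is literally `ProductBound` (`l1 = leftCount`,
`l2 = rightCount`), and `0 < L` because a related pair differs at some bit, where
`1 ≤ l_{x,i} l_{y,i} ≤ L`. -/
theorem stub_relationalAdversary :
    ∀ (n : ℕ) (A : QQueryAlg n) (D : Set (Fin n → Bool)) (f : (Fin n → Bool) → Bool),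
      A.ComputesWithError (1 / 3) D f →
      ∀ (X Y : Finset (Fin n → Bool)) (R : Finset ((Fin n → Bool) × (Fin n → Bool))) (L : ℝ),
        RelWellFormed D f X Y R → ProductBound R L →
          (R.card : ℝ) ≤ 144 * A.queries * Real.sqrt L * Real.sqrt ((X.card : ℝ) * Y.card) := by
  intro n A D f hA X Y R L hR hL
  rcases R.eq_empty_or_nonempty with rfl | hne
  · simp only [Finset.card_empty, Nat.cast_zero]
    positivity
  obtain ⟨p₀, hp₀⟩ := hne
  obtain ⟨hpX, hpY, -, -, hpf⟩ := hR p₀ hp₀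
  have hXr : (0 : ℝ) < X.card := by exact_mod_cast Finset.card_pos.2 ⟨p₀.1, hpX⟩
  have hYr : (0 : ℝ) < Y.card := by exact_mod_cast Finset.card_pos.2 ⟨p₀.2, hpY⟩
  have hD : ∀ e ∈ R, e.1 ∈ D ∧ e.2 ∈ D := fun e he => ⟨(hR e he).2.2.1, (hR e he).2.2.2.1⟩
  have hf : ∀ e ∈ R, f e.1 ≠ f e.2 := fun e he => (hR e he).2.2.2.2
  -- the product hypothesis in the vocabulary of `WeightedAdversary`
  -- (`l1 = leftCount`, `l2 = rightCount` definitionally)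
  have hR' : ∀ e ∈ R, ∀ i, e.1 i ≠ e.2 i → (l1 R e.1 i : ℝ) * l2 R e.2 i ≤ L := hL
  -- `0 < L`: the pair `p₀` differs at some bit `i`, where `1 ≤ l_{x,i} l_{y,i} ≤ L`
  have hLpos : 0 < L := by
    have hne : p₀.1 ≠ p₀.2 := fun h => hpf (by rw [h])
    obtain ⟨i, hi⟩ := Function.ne_iff.1 hne
    have h1 : (1 : ℝ) ≤ l1 R p₀.1 i := by exact_mod_cast one_le_l1 hp₀ hi
    have h2 : (1 : ℝ) ≤ l2 R p₀.2 i := by exact_mod_cast one_le_l2 hp₀ hi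
    have h12 := hR' p₀ hp₀ i hi
    nlinarith
  have hsX : 0 < Real.sqrt (X.card : ℝ) := Real.sqrt_pos.2 hXr
  have hsY : 0 < Real.sqrt (Y.card : ℝ) := Real.sqrt_pos.2 hYr
  set lam : ℝ := Real.sqrt (Y.card : ℝ) / Real.sqrt (X.card : ℝ) with hlam
  have hlampos : 0 < lam := div_pos hsY hsX
  have hmain := card_le_queries_mul A hA R hD hf hLpos hlampos hR'
  -- `R.fst ⊆ X`, `R.snd ⊆ Y`
  have h1 : ((R.image Prod.fst).card : ℝ) ≤ X.card := by
    exact_mod_cast Finset.card_le_card (Finset.image_subset_iff.2 fun e he => (hR e he).1)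
  have h2 : ((R.image Prod.snd).card : ℝ) ≤ Y.card := by
    exact_mod_cast Finset.card_le_card (Finset.image_subset_iff.2 fun e he => (hR e he).2.1)
  have hkey : lam * X.card + Y.card / lam = 2 * Real.sqrt ((X.card : ℝ) * Y.card) := by
    rw [Real.sqrt_mul hXr.le, hlam]
    exact relAdv_balance_eq hsX hsY (Real.mul_self_sqrt hXr.le) (Real.mul_self_sqrt hYr.le)
  have hb : Real.sqrt L * (lam * (R.image Prod.fst).card + (R.image Prod.snd).card / lam) ≤
      Real.sqrt L * (2 * Real.sqrt ((X.card : ℝ) * Y.card)) := by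
    refine mul_le_mul_of_nonneg_left ?_ (Real.sqrt_nonneg _)
    rw [← hkey]
    exact add_le_add (mul_le_mul_of_nonneg_left h1 hlampos.le)
      (div_le_div_of_nonneg_right h2 hlampos.le)
  have hfin := hmain.trans (mul_le_mul_of_nonneg_left hb (Nat.cast_nonneg _))
  have e : (A.queries : ℝ) * (Real.sqrt L * (2 * Real.sqrt ((X.card : ℝ) * Y.card))) =
      144 * A.queries * Real.sqrt L * Real.sqrt ((X.card : ℝ) * Y.card) / 72 := by ring
  rw [e, div_le_div_iff_of_pos_right (by norm_num : (0 : ℝ) < 72)] at hfin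
  exact hfin

end Summit.QuantumAdvantage.QuantumAdvantage.Theorems.WbwVerifiableLineNoSpeedup.CycleSurgery

end
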